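import Summits.AtomisticToContinuum.HydrodynamicLimit.Theorems.JaynesSqueezeBlockGibbsBlockReference
import Summits.AtomisticToContinuum.HydrodynamicLimit.Theorems.JaynesSqueezeSqueezeToBlockGibbsTimeZero
import Summits.AtomisticToContinuum.HydrodynamicLimit.Theorems.CollisionIsometryCLTMacroClosureStubLedgerTransport
import HarnessLib

/-!
# The block-constant reference of `JaynesSqueeze.BlockGibbs`, II: the transport identity
# (support for stmt-AtomisticToContinuum-13462)

Sequel of `JaynesSqueezeBlockGibbsBlockReference`. **The transport identity at a bounded measurable
reference** (`toReal_klDiv_lawAt_localGibbsLaw_of_bounds`, `klDiv_lawAt_localGibbsLaw_eq_ofReal_of_bounds`):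
for the evolved local Gibbs law `λ_N = localGibbsLaw σ a₀ u₀ θ₀ N Φ` (continuous positive data) and a
reference `ψ = localGibbsLaw σ a u θ N Φ` with MEASURABLE parameters in a `BlockGibbs` range
(`A⁻¹ ≤ a ≤ A`, `Θ⁻¹ ≤ θ ≤ Θ`, `‖u‖ ≤ V`, `0 < A, Θ`),
`klDiv(lawAt Φ λ_N t ‖ ψ) = ofReal((N+1)(E_λ⟨emp, log prof₀⟩ − E_λ⟨emp ∘ Φ_t, log prof⟩) + log Z − log Z₀)`
— FINITE, with the kinetic-energy integrability DISCHARGED (`JaynesSqueezeSqueeze.integrable_kineticPair_*`: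
Gaussian equipartition at time `0`, conservation of energy on the good set), and an explicit functional of
ONE-BODY empirical averages along the flow (Liouville invariance of Shannon entropy; Yau 1991 §2,
Olla–Varadhan–Yau 1993 §3; the two-reference identity is `MacroClosureLine.StubLedger.toReal_klDiv_lawAt_particleLaw`,
the continuous-reference case `MacroClosureLine.StubLedger.ledger_transport`, and the squeeze prover's
`JaynesSqueezeSqueeze.toReal_klDiv_lawAt_localGibbsLaw_ref` is the real form with the kinetic hypotheses kept).
Specialised to the block reference of `BlockGibbs` in `klDiv_lawAt_blockRef_eq_ofReal` /
`klDiv_lawAt_blockRef_le_of_le`: the quantity bounded by `δ(N+1)` in `BlockGibbs` is an explicit function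
of the block masses, momenta and kinetic energies of the one-body intensity measure at time `s` plus the
initial entropy term — the starting point of the squeeze (`SqueezeToBlockGibbs`).

No new definitions.
-/

noncomputable section

open MeasureTheory Filter Set Topology InformationTheory
open scoped ENNReal

namespace Summit.AtomisticToContinuum.HydrodynamicLimit.Theorems.BlockGibbsLine

open Literature.MathematicalPhysics.KineticTheory Literature.Analysis.FluidPDE
open Literature.Analysis.FunctionSpaces

/-! ## The transport identity at a bounded measurable reference -/

section Transport

variable {a₀ θ₀ : T3 → ℝ} {u₀ : T3 → V3} {σ : ℝ} {N : ℕ}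

/-- **Transport identity, bounded measurable reference (real form).** For the evolved local Gibbs law
`λ_N = localGibbsLaw σ a₀ u₀ θ₀ N Φ` of continuous positive data and a reference
`ψ = localGibbsLaw σ a u θ N Φ` with measurable parameters in a `BlockGibbs` range (`σ ≤ 1/2`):
`(klDiv(lawAt Φ λ_N t ‖ ψ)).toReal = (N+1)(E_λ⟨emp, log prof₀⟩ − E_λ⟨emp ∘ Φ_t, log prof⟩) + log Z − log Z₀`.
[cite: OllaVaradhanYau1993, §3] -/
theorem toReal_klDiv_lawAt_localGibbsLaw_of_bounds (hσ2 : σ ≤ 1 / 2)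
    (Φ : HardSphereFlow (Torus.geometry (Fin 3)) (hsDiameter σ N) (N + 1))
    (ha : Continuous a₀) (hθ : Continuous θ₀) (hu : Continuous u₀) (ha0 : ∀ x, 0 < a₀ x) (hθ0 : ∀ x, 0 < θ₀ x)
    {A Θ V : ℝ} (hA : 0 < A) (hΘ : 0 < Θ) {a θ : T3 → ℝ} {u : T3 → V3}
    (ham : Measurable a) (hθm : Measurable θ) (hum : Measurable u)
    (hab : ∀ x, A⁻¹ ≤ a x ∧ a x ≤ A) (hθb : ∀ x, Θ⁻¹ ≤ θ x ∧ θ x ≤ Θ) (hub : ∀ x, ‖u x‖ ≤ V) (t : ℝ) :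
    (klDiv (Φ.lawAt (localGibbsLaw σ a₀ u₀ θ₀ N Φ) t) (localGibbsLaw σ a u θ N Φ)).toReal =
      ((N : ℝ) + 1) *
          ((∫ z, (∫ y, Real.log (localGibbsProfile a₀ u₀ θ₀ y) ∂(empiricalMeasure z)) ∂(localGibbsLaw σ a₀ u₀ θ₀ N Φ)) -
            ∫ z, (∫ y, Real.log (localGibbsProfile a u θ y) ∂(empiricalMeasure (Φ.flow t z))) ∂(localGibbsLaw σ a₀ u₀ θ₀ N Φ)) +
        Real.log (canonicalPartition (Torus.geometry (Fin 3)) (hsDiameter σ N) (N + 1) (localGibbsProfile a u θ)) -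
        Real.log (canonicalPartition (Torus.geometry (Fin 3)) (hsDiameter σ N) (N + 1) (localGibbsProfile a₀ u₀ θ₀)) := by
  have haθ : ∀ x, 0 < a x := fun x => (inv_pos.2 hA).trans_le (hab x).1
  have hθθ : ∀ x, 0 < θ x := fun x => (inv_pos.2 hΘ).trans_le (hθb x).1
  have haA : ∀ x, a x ≤ A := fun x => (hab x).2
  -- the three laws as particle laws of positive densities
  set W₀ : Config (N + 1) (Fin 3) T3 → ℝ := fun z =>
    (canonicalPartition (Torus.geometry (Fin 3)) (hsDiameter σ N) (N + 1) (localGibbsProfile a₀ u₀ θ₀))⁻¹ *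
      tensorPow (N + 1) (localGibbsProfile a₀ u₀ θ₀) z with hW₀
  set ψ : Config (N + 1) (Fin 3) T3 → ℝ := fun z =>
    (canonicalPartition (Torus.geometry (Fin 3)) (hsDiameter σ N) (N + 1) (localGibbsProfile a u θ))⁻¹ *
      tensorPow (N + 1) (localGibbsProfile a u θ) z with hψ
  have hlam : localGibbsLaw σ a₀ u₀ θ₀ N Φ = particleLaw Φ W₀ :=
    MacroClosureLine.StubLedger.localGibbsLaw_eq_particleLaw_tensorPow Φ a₀ θ₀ u₀
  have hΨ : localGibbsLaw σ a u θ N Φ = particleLaw Φ ψ :=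
    MacroClosureLine.StubLedger.localGibbsLaw_eq_particleLaw_tensorPow Φ a θ u
  haveI hP : IsProbabilityMeasure (particleLaw Φ W₀) := by
    rw [← hlam]; exact isProbabilityMeasure_localGibbsLaw ha hθ hu ha0 hθ0 hσ2 N Φ
  haveI hPψ : IsProbabilityMeasure (particleLaw Φ ψ) := by
    rw [← hΨ]; exact isProbabilityMeasure_localGibbsLaw' ham hθm hum haθ haA hθθ hσ2 N Φ
  have hWm : Measurable W₀ := MacroClosureLine.StubLedger.measurable_gibbsDensity σ N ha hθ hu
  have hψm : Measurable ψ := measurable_gibbsDensity' σ N ham hθm hum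
  have hW0 : ∀ z, 0 ≤ W₀ z := fun z =>
    (MacroClosureLine.StubLedger.gibbsDensity_pos hσ2 N ha hθ hu ha0 hθ0 z).le
  have hWpos : ∀ z, 0 < W₀ z := fun z => MacroClosureLine.StubLedger.gibbsDensity_pos hσ2 N ha hθ hu ha0 hθ0 z
  have hψpos : ∀ z, 0 < ψ z := fun z => gibbsDensity_pos' hσ2 N ham hθm hum haθ haA hθθ z
  -- `klDiv(λ ‖ λ) = 0`
  have hself : klDiv (particleLaw Φ W₀) (particleLaw Φ W₀) = 0 := klDiv_self _
  -- the log-densities and their integrability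
  set L₁ : Config (N + 1) (Fin 3) T3 → ℝ := fun z =>
    ∫ y, Real.log (localGibbsProfile a₀ u₀ θ₀ y) ∂(empiricalMeasure z) with hL₁
  set L₂ : Config (N + 1) (Fin 3) T3 → ℝ := fun z =>
    ∫ y, Real.log (localGibbsProfile a u θ y) ∂(empiricalMeasure z) with hL₂
  set lZ₁ : ℝ := Real.log
    (canonicalPartition (Torus.geometry (Fin 3)) (hsDiameter σ N) (N + 1) (localGibbsProfile a₀ u₀ θ₀)) with hlZ₁
  set lZ₂ : ℝ := Real.log
    (canonicalPartition (Torus.geometry (Fin 3)) (hsDiameter σ N) (N + 1) (localGibbsProfile a u θ)) with hlZ₂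
  have hlog₁ : ∀ z, Real.log (W₀ z) = ((N : ℝ) + 1) * L₁ z - lZ₁ :=
    MacroClosureLine.StubLedger.log_gibbsDensity hσ2 N ha hθ hu ha0 hθ0
  have hlog₂ : ∀ z, Real.log (ψ z) = ((N : ℝ) + 1) * L₂ z - lZ₂ :=
    log_gibbsDensity' hσ2 N ham hθm hum haθ haA hθθ
  have hK0 : Integrable (fun z => ∫ y, ‖y.2‖ ^ 2 ∂(empiricalMeasure z)) (particleLaw Φ W₀) := by
    rw [← hlam]; exact JaynesSqueezeSqueeze.integrable_kineticPair_localGibbsLaw hσ2 ha hθ hu ha0 hθ0 N Φ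
  have hKt : Integrable (fun z => ∫ y, ‖y.2‖ ^ 2 ∂(empiricalMeasure (Φ.flow t z))) (particleLaw Φ W₀) := by
    rw [← hlam]; exact JaynesSqueezeSqueeze.integrable_kineticPair_flow_localGibbsLaw hσ2 ha hθ hu ha0 hθ0 N Φ t
  have hI₁ : Integrable (fun z => L₁ z) (particleLaw Φ W₀) :=
    MacroClosureLine.StubLedger.integrable_logPair_comp ha hθ hu ha0 hθ0 measurable_id hK0
  have hI₂ : Integrable (fun z => L₂ (Φ.flow t z)) (particleLaw Φ W₀) :=
    (integrable_logPair_comp_of_bounds hA hΘ ham hθm hum hab hθb hub (Φ.measurable_flow t) hKt).1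
  have hA₁ : Integrable (fun z => ((N : ℝ) + 1) * L₁ z) (particleLaw Φ W₀) := hI₁.const_mul _
  have hA₂ : Integrable (fun z => ((N : ℝ) + 1) * L₂ (Φ.flow t z)) (particleLaw Φ W₀) := hI₂.const_mul _
  have hint₁ : Integrable (fun z => Real.log (W₀ z)) (particleLaw Φ W₀) := by
    simp_rw [hlog₁]; exact hA₁.sub (integrable_const _)
  have hint₂ : Integrable (fun z => Real.log (ψ (Φ.flow t z))) (particleLaw Φ W₀) := by
    simp_rw [hlog₂]; exact hA₂.sub (integrable_const _)
  rw [hlam, hΨ, MacroClosureLine.StubLedger.toReal_klDiv_lawAt_particleLaw Φ hWm hWm hψm hW0 hWpos hψpos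
    (by rw [hself]; exact ENNReal.zero_ne_top) t hint₁ hint₂, hself, ENNReal.toReal_zero, zero_add]
  simp_rw [hlog₁, hlog₂]
  have hB : Integrable (fun _ : Config (N + 1) (Fin 3) T3 => lZ₂ - lZ₁) (particleLaw Φ W₀) := integrable_const _
  have hA' : Integrable (fun z => ((N : ℝ) + 1) * L₁ z - ((N : ℝ) + 1) * L₂ (Φ.flow t z)) (particleLaw Φ W₀) :=
    hA₁.sub hA₂
  rw [show (fun z => ((N : ℝ) + 1) * L₁ z - lZ₁ - (((N : ℝ) + 1) * L₂ (Φ.flow t z) - lZ₂)) =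
      fun z => ((N : ℝ) + 1) * L₁ z - ((N : ℝ) + 1) * L₂ (Φ.flow t z) + (lZ₂ - lZ₁) from funext fun z => by ring,
    integral_add hA' hB, integral_sub hA₁ hA₂, integral_const_mul, integral_const_mul, integral_const,
    smul_eq_mul, probReal_univ, one_mul]
  ring

/-- **Finiteness and the transport identity in `ℝ≥0∞`.** Under the hypotheses of
`toReal_klDiv_lawAt_localGibbsLaw_of_bounds` the relative entropy of the evolved law with respect to a
bounded measurable local Gibbs reference is FINITE and equals
`ofReal((N+1)(E_λ⟨emp, log prof₀⟩ − E_λ⟨emp ∘ Φ_t, log prof⟩) + log Z − log Z₀)`.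
[cite: OllaVaradhanYau1993, §3] -/
theorem klDiv_lawAt_localGibbsLaw_eq_ofReal_of_bounds (hσ2 : σ ≤ 1 / 2)
    (Φ : HardSphereFlow (Torus.geometry (Fin 3)) (hsDiameter σ N) (N + 1))
    (ha : Continuous a₀) (hθ : Continuous θ₀) (hu : Continuous u₀) (ha0 : ∀ x, 0 < a₀ x) (hθ0 : ∀ x, 0 < θ₀ x)
    {A Θ V : ℝ} (hA : 0 < A) (hΘ : 0 < Θ) {a θ : T3 → ℝ} {u : T3 → V3}
    (ham : Measurable a) (hθm : Measurable θ) (hum : Measurable u)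
    (hab : ∀ x, A⁻¹ ≤ a x ∧ a x ≤ A) (hθb : ∀ x, Θ⁻¹ ≤ θ x ∧ θ x ≤ Θ) (hub : ∀ x, ‖u x‖ ≤ V) (t : ℝ) :
    klDiv (Φ.lawAt (localGibbsLaw σ a₀ u₀ θ₀ N Φ) t) (localGibbsLaw σ a u θ N Φ) =
      ENNReal.ofReal (((N : ℝ) + 1) *
          ((∫ z, (∫ y, Real.log (localGibbsProfile a₀ u₀ θ₀ y) ∂(empiricalMeasure z)) ∂(localGibbsLaw σ a₀ u₀ θ₀ N Φ)) -
            ∫ z, (∫ y, Real.log (localGibbsProfile a u θ y) ∂(empiricalMeasure (Φ.flow t z))) ∂(localGibbsLaw σ a₀ u₀ θ₀ N Φ)) +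
        Real.log (canonicalPartition (Torus.geometry (Fin 3)) (hsDiameter σ N) (N + 1) (localGibbsProfile a u θ)) -
        Real.log (canonicalPartition (Torus.geometry (Fin 3)) (hsDiameter σ N) (N + 1) (localGibbsProfile a₀ u₀ θ₀))) := by
  rw [← toReal_klDiv_lawAt_localGibbsLaw_of_bounds hσ2 Φ ha hθ hu ha0 hθ0 hA hΘ ham hθm hum hab hθb hub t,
    ENNReal.ofReal_toReal]
  -- finiteness: the log-likelihood ratio is integrable
  have haθ : ∀ x, 0 < a x := fun x => (inv_pos.2 hA).trans_le (hab x).1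
  have hθθ : ∀ x, 0 < θ x := fun x => (inv_pos.2 hΘ).trans_le (hθb x).1
  have haA : ∀ x, a x ≤ A := fun x => (hab x).2
  set W₀ : Config (N + 1) (Fin 3) T3 → ℝ := fun z =>
    (canonicalPartition (Torus.geometry (Fin 3)) (hsDiameter σ N) (N + 1) (localGibbsProfile a₀ u₀ θ₀))⁻¹ *
      tensorPow (N + 1) (localGibbsProfile a₀ u₀ θ₀) z with hW₀
  set ψ : Config (N + 1) (Fin 3) T3 → ℝ := fun z =>
    (canonicalPartition (Torus.geometry (Fin 3)) (hsDiameter σ N) (N + 1) (localGibbsProfile a u θ))⁻¹ *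
      tensorPow (N + 1) (localGibbsProfile a u θ) z with hψ
  have hlam : localGibbsLaw σ a₀ u₀ θ₀ N Φ = particleLaw Φ W₀ :=
    MacroClosureLine.StubLedger.localGibbsLaw_eq_particleLaw_tensorPow Φ a₀ θ₀ u₀
  have hΨ : localGibbsLaw σ a u θ N Φ = particleLaw Φ ψ :=
    MacroClosureLine.StubLedger.localGibbsLaw_eq_particleLaw_tensorPow Φ a θ u
  haveI hP : IsProbabilityMeasure (particleLaw Φ W₀) := by
    rw [← hlam]; exact isProbabilityMeasure_localGibbsLaw ha hθ hu ha0 hθ0 hσ2 N Φ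
  haveI hPψ : IsProbabilityMeasure (particleLaw Φ ψ) := by
    rw [← hΨ]; exact isProbabilityMeasure_localGibbsLaw' ham hθm hum haθ haA hθθ hσ2 N Φ
  have hWm : Measurable W₀ := MacroClosureLine.StubLedger.measurable_gibbsDensity σ N ha hθ hu
  have hψm : Measurable ψ := measurable_gibbsDensity' σ N ham hθm hum
  have hW0 : ∀ z, 0 ≤ W₀ z := fun z =>
    (MacroClosureLine.StubLedger.gibbsDensity_pos hσ2 N ha hθ hu ha0 hθ0 z).le
  have hψpos : ∀ z, 0 < ψ z := fun z => gibbsDensity_pos' hσ2 N ham hθm hum haθ haA hθθ z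
  have hlog₁ : ∀ z, Real.log (W₀ z) =
      ((N : ℝ) + 1) * (∫ y, Real.log (localGibbsProfile a₀ u₀ θ₀ y) ∂(empiricalMeasure z)) -
        Real.log (canonicalPartition (Torus.geometry (Fin 3)) (hsDiameter σ N) (N + 1) (localGibbsProfile a₀ u₀ θ₀)) :=
    MacroClosureLine.StubLedger.log_gibbsDensity hσ2 N ha hθ hu ha0 hθ0
  have hlog₂ : ∀ z, Real.log (ψ z) =
      ((N : ℝ) + 1) * (∫ y, Real.log (localGibbsProfile a u θ y) ∂(empiricalMeasure z)) -
        Real.log (canonicalPartition (Torus.geometry (Fin 3)) (hsDiameter σ N) (N + 1) (localGibbsProfile a u θ)) :=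
    log_gibbsDensity' hσ2 N ham hθm hum haθ haA hθθ
  have hK0 : Integrable (fun z => ∫ y, ‖y.2‖ ^ 2 ∂(empiricalMeasure z)) (particleLaw Φ W₀) := by
    rw [← hlam]; exact JaynesSqueezeSqueeze.integrable_kineticPair_localGibbsLaw hσ2 ha hθ hu ha0 hθ0 N Φ
  have hKt : Integrable (fun z => ∫ y, ‖y.2‖ ^ 2 ∂(empiricalMeasure (Φ.flow t z))) (particleLaw Φ W₀) := by
    rw [← hlam]; exact JaynesSqueezeSqueeze.integrable_kineticPair_flow_localGibbsLaw hσ2 ha hθ hu ha0 hθ0 N Φ t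
  have hint₁ : Integrable (fun z => Real.log (W₀ z)) (particleLaw Φ W₀) := by
    simp_rw [hlog₁]
    exact ((MacroClosureLine.StubLedger.integrable_logPair_comp ha hθ hu ha0 hθ0 measurable_id hK0).const_mul _).sub
      (integrable_const _)
  have hint₂ : Integrable (fun z => Real.log (ψ (Φ.flow t z))) (particleLaw Φ W₀) := by
    simp_rw [hlog₂]
    exact ((integrable_logPair_comp_of_bounds hA hΘ ham hθm hum hab hθb hub (Φ.measurable_flow t) hKt).1.const_mul _).sub
      (integrable_const _)
  -- the law at time `t` and its log-likelihood ratio against `ψ dZ`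
  have hf : Measurable fun z => ENNReal.ofReal (W₀ z) := ENNReal.measurable_ofReal.comp hWm
  have hμL : particleLaw Φ W₀ ≪ liouville (Torus.geometry (Fin 3)) (N + 1) (hsDiameter σ N) :=
    withDensity_absolutelyContinuous _ _
  have hgood : ∀ᵐ z ∂(particleLaw Φ W₀), z ∈ Φ.good := hμL.ae_le Φ.ae_mem_good
  have hlaw : Φ.lawAt (particleLaw Φ W₀) t = particleLaw Φ fun z => W₀ (Φ.flow (-t) z) :=
    HardSphereFlow.lawAt_withDensity_holds Φ hf t
  haveI hPt : IsProbabilityMeasure (particleLaw Φ fun z => W₀ (Φ.flow (-t) z)) := by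
    rw [← hlaw, HardSphereFlow.lawAt_eq]
    exact Measure.isProbabilityMeasure_map (Φ.measurable_flow t).aemeasurable
  have hg : Measurable fun z => ENNReal.ofReal (ψ z) := ENNReal.measurable_ofReal.comp hψm
  have hg0 : ∀ᵐ z ∂(liouville (Torus.geometry (Fin 3)) (N + 1) (hsDiameter σ N)), ENNReal.ofReal (ψ z) ≠ 0 :=
    ae_of_all _ fun z => (ENNReal.ofReal_pos.mpr (hψpos z)).ne'
  have hμtL : (particleLaw Φ fun z => W₀ (Φ.flow (-t) z)) ≪ liouville (Torus.geometry (Fin 3)) (N + 1) (hsDiameter σ N) :=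
    withDensity_absolutelyContinuous _ _
  have hLν : liouville (Torus.geometry (Fin 3)) (N + 1) (hsDiameter σ N) ≪ particleLaw Φ ψ :=
    withDensity_absolutelyContinuous' hg.aemeasurable hg0
  rw [hlam, hΨ, hlaw]
  refine klDiv_ne_top (hμtL.trans hLν) ?_
  refine Integrable.congr ?_ (MacroClosureLine.StubLedger.llr_particleLaw_ae (W := fun z => W₀ (Φ.flow (-t) z)) Φ
    (hWm.comp (Φ.measurable_flow (-t))) hψm (fun z => hW0 _) hψpos).symm
  -- integrability of `log W₀ ∘ Φ_{-t} − log ψ` under the time-`t` law = of `log W₀ − log ψ ∘ Φ_t` under `P`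
  have hF : AEStronglyMeasurable (fun z => Real.log (W₀ (Φ.flow (-t) z)) - Real.log (ψ z))
      (Measure.map (Φ.flow t) (particleLaw Φ W₀)) :=
    ((Real.measurable_log.comp (hWm.comp (Φ.measurable_flow (-t)))).sub
      (Real.measurable_log.comp hψm)).aestronglyMeasurable
  rw [← hlaw, HardSphereFlow.lawAt_eq, integrable_map_measure hF (Φ.measurable_flow t).aemeasurable]
  refine (hint₁.sub hint₂).congr ?_
  filter_upwards [hgood] with z hz
  simp only [Function.comp_apply, Pi.sub_apply]
  rw [Φ.flow_neg_flow t hz]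

end Transport

/-! ## The block reference of `BlockGibbs` -/

section BlockRef

variable {a₀ θ₀ : T3 → ℝ} {u₀ : T3 → V3} {σ : ℝ} {N : ℕ} {A Θ V : ℝ}
  {ca cθ : (Fin 3 → ℕ) → ℝ} {cu : (Fin 3 → ℕ) → V3}

/-- **`BlockGibbs` bookkeeping.** For continuous positive data `(a₀, u₀, θ₀)`, `σ ≤ 1/2`, a flow `Φ`,
a block scale `m` and block parameters `(ca, cu, cθ)` in the `BlockGibbs` range, the quantity bounded
in `BlockGibbs` is finite and explicit:
`klDiv(lawAt Φ λ_N t ‖ ψ_block) = ofReal((N+1)(E_λ⟨emp, log prof₀⟩ − E_λ⟨emp ∘ Φ_t, log prof_block⟩) + log Z_block − log Z₀)`.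
[cite: Yau1991, §2] -/
theorem klDiv_lawAt_blockRef_eq_ofReal (hσ2 : σ ≤ 1 / 2)
    (Φ : HardSphereFlow (Torus.geometry (Fin 3)) (hsDiameter σ N) (N + 1))
    (ha : Continuous a₀) (hθ : Continuous θ₀) (hu : Continuous u₀) (ha0 : ∀ x, 0 < a₀ x) (hθ0 : ∀ x, 0 < θ₀ x)
    (hA : 0 < A) (hΘ : 0 < Θ) (hR : ∀ k, A⁻¹ ≤ ca k ∧ ca k ≤ A ∧ Θ⁻¹ ≤ cθ k ∧ cθ k ≤ Θ ∧ ‖cu k‖ ≤ V)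
    (m : ℕ) (t : ℝ) :
    klDiv (Φ.lawAt (localGibbsLaw σ a₀ u₀ θ₀ N Φ) t)
        (localGibbsLaw σ (fun x => ca (fun i : Fin 3 => ⌊(m : ℝ) * Torus.repr x i⌋₊))
          (fun x => cu (fun i : Fin 3 => ⌊(m : ℝ) * Torus.repr x i⌋₊))
          (fun x => cθ (fun i : Fin 3 => ⌊(m : ℝ) * Torus.repr x i⌋₊)) N Φ) =
      ENNReal.ofReal (((N : ℝ) + 1) *
          ((∫ z, (∫ y, Real.log (localGibbsProfile a₀ u₀ θ₀ y) ∂(empiricalMeasure z)) ∂(localGibbsLaw σ a₀ u₀ θ₀ N Φ)) -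
            ∫ z, (∫ y, Real.log (localGibbsProfile (fun x => ca (fun i : Fin 3 => ⌊(m : ℝ) * Torus.repr x i⌋₊))
              (fun x => cu (fun i : Fin 3 => ⌊(m : ℝ) * Torus.repr x i⌋₊))
              (fun x => cθ (fun i : Fin 3 => ⌊(m : ℝ) * Torus.repr x i⌋₊)) y)
                ∂(empiricalMeasure (Φ.flow t z))) ∂(localGibbsLaw σ a₀ u₀ θ₀ N Φ)) +
        Real.log (canonicalPartition (Torus.geometry (Fin 3)) (hsDiameter σ N) (N + 1)
          (localGibbsProfile (fun x => ca (fun i : Fin 3 => ⌊(m : ℝ) * Torus.repr x i⌋₊))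
            (fun x => cu (fun i : Fin 3 => ⌊(m : ℝ) * Torus.repr x i⌋₊))
            (fun x => cθ (fun i : Fin 3 => ⌊(m : ℝ) * Torus.repr x i⌋₊)))) -
        Real.log (canonicalPartition (Torus.geometry (Fin 3)) (hsDiameter σ N) (N + 1) (localGibbsProfile a₀ u₀ θ₀))) :=
  klDiv_lawAt_localGibbsLaw_eq_ofReal_of_bounds hσ2 Φ ha hθ hu ha0 hθ0 hA hΘ (measurable_comp_blockIdx ca m)
    (measurable_comp_blockIdx cθ m) (measurable_comp_blockIdx cu m) (fun _ => ⟨(hR _).1, (hR _).2.1⟩)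
    (fun _ => ⟨(hR _).2.2.1, (hR _).2.2.2.1⟩) (fun _ => (hR _).2.2.2.2) t

/-- **Reduction of `BlockGibbs` to a real inequality.** With the notation of `klDiv_lawAt_blockRef_eq_ofReal`,
the `klDiv` bound asked by `BlockGibbs` for given block parameters in the range is EQUIVALENT to the real
inequality `(N+1)(E_λ⟨emp, log prof₀⟩ − E_λ⟨emp ∘ Φ_t, log prof_block⟩) + log Z_block − log Z₀ ≤ δ (N+1)`
whenever the latter's left side is nonnegative-or-not (`ofReal` is monotone and the right side is `≥ 0`):
the sufficient direction, which is the one a proof of `BlockGibbs` uses. [folklore] -/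
theorem klDiv_lawAt_blockRef_le_of_le (hσ2 : σ ≤ 1 / 2)
    (Φ : HardSphereFlow (Torus.geometry (Fin 3)) (hsDiameter σ N) (N + 1))
    (ha : Continuous a₀) (hθ : Continuous θ₀) (hu : Continuous u₀) (ha0 : ∀ x, 0 < a₀ x) (hθ0 : ∀ x, 0 < θ₀ x)
    (hA : 0 < A) (hΘ : 0 < Θ) (hR : ∀ k, A⁻¹ ≤ ca k ∧ ca k ≤ A ∧ Θ⁻¹ ≤ cθ k ∧ cθ k ≤ Θ ∧ ‖cu k‖ ≤ V)
    (m : ℕ) (t : ℝ) {b : ℝ}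
    (hle : ((N : ℝ) + 1) *
          ((∫ z, (∫ y, Real.log (localGibbsProfile a₀ u₀ θ₀ y) ∂(empiricalMeasure z)) ∂(localGibbsLaw σ a₀ u₀ θ₀ N Φ)) -
            ∫ z, (∫ y, Real.log (localGibbsProfile (fun x => ca (fun i : Fin 3 => ⌊(m : ℝ) * Torus.repr x i⌋₊))
              (fun x => cu (fun i : Fin 3 => ⌊(m : ℝ) * Torus.repr x i⌋₊))
              (fun x => cθ (fun i : Fin 3 => ⌊(m : ℝ) * Torus.repr x i⌋₊)) y)
                ∂(empiricalMeasure (Φ.flow t z))) ∂(localGibbsLaw σ a₀ u₀ θ₀ N Φ)) +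
        Real.log (canonicalPartition (Torus.geometry (Fin 3)) (hsDiameter σ N) (N + 1)
          (localGibbsProfile (fun x => ca (fun i : Fin 3 => ⌊(m : ℝ) * Torus.repr x i⌋₊))
            (fun x => cu (fun i : Fin 3 => ⌊(m : ℝ) * Torus.repr x i⌋₊))
            (fun x => cθ (fun i : Fin 3 => ⌊(m : ℝ) * Torus.repr x i⌋₊)))) -
        Real.log (canonicalPartition (Torus.geometry (Fin 3)) (hsDiameter σ N) (N + 1) (localGibbsProfile a₀ u₀ θ₀)) ≤ b) :
    klDiv (Φ.lawAt (localGibbsLaw σ a₀ u₀ θ₀ N Φ) t)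
        (localGibbsLaw σ (fun x => ca (fun i : Fin 3 => ⌊(m : ℝ) * Torus.repr x i⌋₊))
          (fun x => cu (fun i : Fin 3 => ⌊(m : ℝ) * Torus.repr x i⌋₊))
          (fun x => cθ (fun i : Fin 3 => ⌊(m : ℝ) * Torus.repr x i⌋₊)) N Φ) ≤ ENNReal.ofReal b := by
  rw [klDiv_lawAt_blockRef_eq_ofReal hσ2 Φ ha hθ hu ha0 hθ0 hA hΘ hR m t]
  exact ENNReal.ofReal_le_ofReal hle

end BlockRef

end Summit.AtomisticToContinuum.HydrodynamicLimit.Theorems.BlockGibbsLine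

end
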